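import Literature.Probability.RandomPlanarGeometry.TriangleDomain
import Literature.Probability.RandomPlanarGeometry.CritPercCardyFunction
import Literature.Probability.Percolation.SmirnovTheorem
import HarnessLib

/-!
# The Cardy–Carleson identity: (C) of `SmirnovTheorem.lean` is crit-perc.S17

Topic `Literature/Probability/Percolation`. Layer 1 of the decomposition of crit-perc.S03
(`SmirnovTheorem.lean`) isolated the named fact **(C)**
`cardyFunction_crossRatio_eq_carlesonRatio`: for a conformal rectangle `R = (Ω; a', b', c', d')`
with a uniformizing datum `(φ, x)` from `ℍ` and a Carleson map `ψ : Ω → Δ = openTriangle a b c`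
(`a', b', c', d' ↦ a, b, c, d`, `d ∈ (c, a)`), Cardy's function of Cardy's cross-ratio is
Carleson's ratio, `F(η(x)) = |d - c| / |a - c|` (Cardy 1992, eq. (8); Bollobás–Riordan 2006,
Ch. 7 (3), p. 163: `π(T_x) = x`). This file PROVES that (C) is equivalent to the tree's
**crit-perc.S17** `cardyFunction_crossRatio_eq_of_equilateral` (`CritPercCardyFunction.lean`),
which is the special case `Ω = Δ`, `ψ = id`:

* `cardyFunction_crossRatio_eq_carlesonRatio_of_equilateral` (S17 ⇒ (C)): package the triangle
  as Carleson's conformal rectangle `triangleRectangle a b c _ s _` (`TriangleDomain.lean`,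
  Bollobás–Riordan's `T_x`) and uniformize it by the composite `φ.trans ψ : ℍ → Ω → Δ`, whose
  boundary values at `x i` are `a, b, c, d` (`hasBoundaryValue_trans`: boundary values compose,
  because a conformal equivalence maps its source into its target); then S17 applies verbatim.
* `cardyFunction_crossRatio_eq_of_equilateral_of_carleson` ((C) ⇒ S17): for `Ω = Δ` the identity
  map is a Carleson map (`ConformalEquiv.ofEq`, the identity across a propositional equality of
  carriers).

Consequently crit-perc.S03 follows from (A), (B) of `SmirnovTheorem.lean` and S17
(`hasCrossingLimit_triDomainCrossingProb_of_S17`).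

## Mathlib

USED: `Filter.Tendsto`, `nhdsWithin`, `openSegment_eq_image'`, `PartialEquiv`. Nothing to add.

## References

* J. Cardy, *Critical percolation in finite geometries*, J. Phys. A 25 (1992) L201–L206, eq. (8).
* B. Bollobás, O. Riordan, *Percolation*, CUP (2006), Ch. 7, (3) p. 163 and p. 196.
* S. Smirnov, arXiv:0909.4499, Cor. 3.
-/

open Set Filter Topology
open UpperHalfPlane (upperHalfPlaneSet)

noncomputable section

namespace Literature.Probability.Percolation

section ConformalEquiv
open Literature.Probability.RandomPlanarGeometry (ConformalEquiv)
open Literature.Probability.RandomPlanarGeometry.ConformalEquiv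

variable {U V W : Set ℂ}

/-- **Boundary values compose.** If `φ : U → V` has boundary value `p` at `x` and `ψ : V → W` has
boundary value `q` at `p`, then `ψ ∘ φ : U → W` has boundary value `q` at `x` (as `z → x` within
`U`, `φ z → p` within `V` because `φ` maps `U` into `V`). Pommerenke 1992, §2.1. [folklore] -/
theorem _root_.Literature.Probability.RandomPlanarGeometry.ConformalEquiv.hasBoundaryValue_trans (φ : ConformalEquiv U V) (ψ : ConformalEquiv V W) {x p q : ℂ}
    (hφ : φ.HasBoundaryValue x p) (hψ : ψ.HasBoundaryValue p q) :
    (φ.trans ψ).HasBoundaryValue x q := by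
  have h1 : Tendsto φ (𝓝[U] x) (𝓝[V] p) :=
    tendsto_nhdsWithin_iff.2 ⟨hφ, eventually_mem_nhdsWithin.mono fun z hz => φ.mapsTo hz⟩
  exact hψ.comp h1

/-- The identity as a conformal equivalence `U → V` across a (propositional) equality `U = V`.
(Ahlfors 1979, Ch. 6 §1.1.) [folklore] -/
def _root_.Literature.Probability.RandomPlanarGeometry.ConformalEquiv.ofEq (h : U = V) : ConformalEquiv U V where
  toFun := id
  invFun := id
  source := U
  target := V
  map_source' _ hz := h ▸ hz
  map_target' _ hz := h.symm ▸ hz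
  left_inv' _ _ := rfl
  right_inv' _ _ := rfl
  source_eq := rfl
  target_eq := rfl
  differentiableOn := differentiableOn_id
  differentiableOn_symm := differentiableOn_id

/-- `ofEq` acts as the identity. [folklore] -/
@[simp] theorem _root_.Literature.Probability.RandomPlanarGeometry.ConformalEquiv.ofEq_apply (h : U = V) (z : ℂ) : ofEq h z = z := rfl

/-- The identity `ofEq` has boundary value `x` at every point `x`. [folklore] -/
theorem _root_.Literature.Probability.RandomPlanarGeometry.ConformalEquiv.hasBoundaryValue_ofEq (h : U = V) (x : ℂ) : (ofEq h).HasBoundaryValue x x :=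
  show Tendsto (fun z : ℂ => z) (𝓝[U] x) (𝓝 x) from
    (continuous_id.tendsto x).mono_left nhdsWithin_le_nhds

end ConformalEquiv

section CritPerc

open LatticeModels

/-- A point of the open side `(c, a)` is `c + s (a - c)` with `s ∈ (0, 1)`. [folklore] -/
theorem exists_eq_add_smul_of_mem_openSegment {a c d : ℂ} (hd : d ∈ openSegment ℝ c a) :
    ∃ s ∈ Ioo (0 : ℝ) 1, d = c + s • (a - c) := by
  rw [openSegment_eq_image'] at hd
  obtain ⟨s, hs, rfl⟩ := hd
  exact ⟨s, hs, rfl⟩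

/-- **S17 ⇒ (C).** Cardy's formula in Carleson's form for the triangle (crit-perc.S17,
`cardyFunction_crossRatio_eq_of_equilateral`) implies the Cardy–Carleson identity (C) of
`SmirnovTheorem.lean` for every conformal rectangle: uniformize Carleson's rectangle
`(Δ; a, b, c, d) = triangleRectangle a b c _ s _` by `φ.trans ψ : ℍ → Ω → Δ`, whose boundary
values at `x i` are `a, b, c, d`. (Bollobás–Riordan 2006, p. 196: `π(D₄) = x` "may be defined"
through the conformal map onto the triangle; (3) p. 163.) [cite: BollobasRiordan2006, Ch. 7 (3) p. 163 and p. 196] -/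
theorem cardyFunction_crossRatio_eq_carlesonRatio_of_equilateral
    (h17 : RandomPlanarGeometry.cardyFunction_crossRatio_eq_of_equilateral) :
    cardyFunction_crossRatio_eq_carlesonRatio := by
  intro R a b c d ψ φ x habc hd hψ hφ
  obtain ⟨s, hs, rfl⟩ := exists_eq_add_smul_of_mem_openSegment hd
  have hind : AffineIndependent ℝ ![a, b, c] :=
    RandomPlanarGeometry.affineIndependent_of_dist_eq habc.1 habc.2.1 habc.2.2
  have hac : a ≠ c := habc.ne₁₃
  obtain ⟨h0, h1, h2, h3⟩ := RandomPlanarGeometry.triangleRectangle_pt hind hs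
  -- the marked points of Carleson's rectangle `T = triangleRectangle a b c _ s _`
  have hpt : ∀ i : Fin 4,
      (RandomPlanarGeometry.triangleRectangle a b c hind s hs).pt i = ![a, b, c, c + s • (a - c)] i := by
    intro i
    fin_cases i
    exacts [h0, h1, h2, h3]
  -- the composite uniformizing map `ℍ → Ω → Δ = T.carrier` has boundary values `a, b, c, d`
  have hbv : ∀ i : Fin 4, (φ.trans ψ).HasBoundaryValue (x i) (![a, b, c, c + s • (a - c)] i) := by
    intro i
    fin_cases i
    · exact RandomPlanarGeometry.ConformalEquiv.hasBoundaryValue_trans φ ψ (hφ.2 0) hψ.1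
    · exact RandomPlanarGeometry.ConformalEquiv.hasBoundaryValue_trans φ ψ (hφ.2 1) hψ.2.1
    · exact RandomPlanarGeometry.ConformalEquiv.hasBoundaryValue_trans φ ψ (hφ.2 2) hψ.2.2.1
    · exact RandomPlanarGeometry.ConformalEquiv.hasBoundaryValue_trans φ ψ (hφ.2 3) hψ.2.2.2
  have hΦ : (RandomPlanarGeometry.triangleRectangle a b c hind s hs).IsUniformizing (φ.trans ψ) x := by
    refine ⟨hφ.1, fun i => ?_⟩
    rw [hpt i]
    exact hbv i
  have hdc : c + s • (a - c) ≠ c := by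
    intro h
    have : s • (a - c) = 0 := by simpa using h
    rcases smul_eq_zero.1 this with h' | h'
    · exact hs.1.ne' h'
    · exact hac (sub_eq_zero.1 h')
  have hda : c + s • (a - c) ≠ a := by
    intro h
    have : (s - 1) • (a - c) = 0 := by
      rw [sub_smul, one_smul, sub_eq_zero]
      exact (eq_sub_of_add_eq' h)
    rcases smul_eq_zero.1 this with h' | h'
    · exact hs.2.ne (sub_eq_zero.1 h')
    · exact hac (sub_eq_zero.1 h')
  have key := h17 (RandomPlanarGeometry.triangleRectangle a b c hind s hs) a b c (c + s • (a - c)) habc rfl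
    ⟨h0, h1, h2, h3⟩ (openSegment_subset_segment ℝ c a hd) hdc hda hΦ
  rw [key, carlesonRatio]

/-- **(C) ⇒ S17.** Conversely the Cardy–Carleson identity for all conformal rectangles gives back
crit-perc.S17: for `Ω = Δ` with marked points `a, b, c, d` the identity map is a Carleson map.
(Bollobás–Riordan 2006, (3) p. 163.) [cite: BollobasRiordan2006, Ch. 7 (3) p. 163] -/
theorem cardyFunction_crossRatio_eq_of_equilateral_of_carleson
    (hC : cardyFunction_crossRatio_eq_carlesonRatio) :
    RandomPlanarGeometry.cardyFunction_crossRatio_eq_of_equilateral := by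
  intro R a b c d habc hR hpt hd hdc hda φ x hφ
  obtain ⟨rfl, rfl, rfl, rfl⟩ := hpt
  have hd' : R.pt 3 ∈ openSegment ℝ (R.pt 2) (R.pt 0) :=
    mem_openSegment_of_ne_left_right hdc.symm hda.symm hd
  let ψ : RandomPlanarGeometry.ConformalEquiv R.carrier (openTriangle (R.pt 0) (R.pt 1) (R.pt 2)) :=
    RandomPlanarGeometry.ConformalEquiv.ofEq hR
  have hψ : IsCarlesonMap R (R.pt 0) (R.pt 1) (R.pt 2) (R.pt 3) ψ :=
    ⟨RandomPlanarGeometry.ConformalEquiv.hasBoundaryValue_ofEq hR (R.pt 0), RandomPlanarGeometry.ConformalEquiv.hasBoundaryValue_ofEq hR _,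
      RandomPlanarGeometry.ConformalEquiv.hasBoundaryValue_ofEq hR _, RandomPlanarGeometry.ConformalEquiv.hasBoundaryValue_ofEq hR _⟩
  have key := hC R _ _ _ _ ψ φ x habc hd' hψ hφ
  rw [key, carlesonRatio]

/-- **crit-perc.S03 from (A), (B) and S17**: Smirnov's theorem in Carleson's form, the existence
of Carleson maps and Cardy's formula for the triangle imply Cardy's formula for critical site
percolation on `δ𝕋` in the form `hasCrossingLimit_triDomainCrossingProb`.
(Bollobás–Riordan 2006, Ch. 7 Thm. 2, proof pp. 202–203, with (3) p. 163.) [cite: BollobasRiordan2006, Ch. 7 Thm. 2 (proof pp. 202–203) and (3) p. 163] -/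
theorem hasCrossingLimit_triDomainCrossingProb_of_S17 (hB : exists_isCarlesonMap)
    (hA : smirnov_tendsto_triDomainCrossingProb)
    (h17 : RandomPlanarGeometry.cardyFunction_crossRatio_eq_of_equilateral) :
    hasCrossingLimit_triDomainCrossingProb :=
  hasCrossingLimit_triDomainCrossingProb_of_carleson hB hA
    (cardyFunction_crossRatio_eq_carlesonRatio_of_equilateral h17)

end CritPerc

end Literature.Probability.Percolation

end
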